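import Mathlib
import Summits.Ventures.HodgeRepro.Tier4.Target
import Summits.Ventures.HodgeRepro.Tier4.Line3.Defs
import Summits.Ventures.HodgeRepro.Tier4.Line3.DefsLemmas
import Summits.Ventures.HodgeRepro.Tier4.Line3.LocaliserS
import Summits.Ventures.HodgeRepro.Tier4.Line3.HeckeEquivarianceLemmas
import Summits.Ventures.HodgeRepro.Tier4.Line3.GrowthInvOfGauss
import Summits.Ventures.HodgeRepro.Tier4.Line3.GrowthInvOfMajorant

/-!
# Tier4/Line3/CoefMajorantWitness — the honest witness of `HasCoefMajorant`: content × the EXACT `H`-Gaussian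

Blind re-derivation cell `pub-hodge-repro`, Tier 4 «PROVE THE STEP» (README §9–§10), LINE L3, lemma L3.5
`term_dominated`; seat t4-L2-p3 (gen 3); companion of `GrowthInvOfMajorant` (p676532) and answer to t4-plan-3's
remark (S13257): with the EUCLIDEAN Gaussian `gaussDefAt c₁` as the majorant `m`, the representative clause
`m (r x) ≤ q₃^N m x` of `HasCoefMajorant` FAILS (the ratio `gaussDefAt c₁ x / gaussDefAt (c₁ / R) x` tends to `0`);
the honest witness is the EXACT `H`-Gaussian `gaussDef x = ∏_{σ def} exp (−π |σ(H)[x]|)` of `Defs` — invariant under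
all of `U(H)(E′)` on the nose — times a content-like factor `κ`.  This module states that as a theorem:

* `gaussDef_mulVec_of_unitary`: `gaussDef (γ x) = gaussDef x` for every `γ ∈ U(H)(E′)` (`hform_unitary`; the
  Witness module's `gaussDef_mulVec` is the case `γ ∈ Γ` — the Hecke representatives need the general one);
* `defPoly e′ x = ∏_{σ def} (1 + Σ_i ‖σ x_i‖²)^{e′}`, the polynomial of the definite sizes, and
  `exists_defPoly_mul_gaussDef_le_gaussDefAt`: `defPoly e′ x · gaussDef x ≤ K · gaussDefAt c₁ x` for some `c₁ > 0`,
  `K ≥ 0` — definiteness of the `H_σ` (the positive-definite lower bound of p675191) and the elementary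
  `(1 + s)^{e′} ≤ K e^{δ s}` (`exists_one_add_rpow_le_exp`);
* **`hasCoefMajorant_of_content`**: a non-negative `κ` with `‖cf j x‖ ≤ C κ(x) gaussDef(x)`, `Γ`-invariant, moved by
  `q₃^N` under the localiser's representatives, and of polynomial size `κ x ≤ A (1 + ‖y(x)‖)^e · defPoly e′ x`,
  gives `HasCoefMajorant D ℓ` with `m = κ · gaussDef / max (A K) 1`.  For the genuine data `κ = N(𝔠(x))^{e′}`, the
  norm of the content ideal (paper note proofs/t4/L3/COEF-MAJORANT-RUNG.md §2): `Γ ⊆ GL₃(𝒪)` preserves the content,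
  `r⁻¹` has `𝔭𝔭̄`-denominators of depth `≤ N`, and `N(𝔠(x)) ≤ |N_{E′/ℚ}(x_i)| = |τ₀ x_i|² ∏_{σ def} |σ x_i|` — none of
  which is typed here (the content ideal is not an object of the tree).  The Euclidean Gaussian never enters `m`.

No printed input is consumed; nothing here asserts anything about the truth of (P); HC_CM is NOT proved by anyone
in this repository.
-/

set_option autoImplicit false

noncomputable section

namespace Summit.Ventures.HodgeRepro.Tier4.Line3

open Summit.Ventures.HodgeRepro.Tier4
open Matrix NumberField
open scoped ComplexConjugate

/-! ### 1. The elementary bound `(1 + s)^{e′} ≤ K e^{δ s}` -/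

/-- `(1 + s)^{e′} ≤ K · exp (δ s)` for all `s ≥ 0`, for every `e′ ≥ 0` and `δ > 0` (`K = 1` if `e′ ≤ δ`,
`K = (e′/δ)^{e′}` otherwise). -/
theorem exists_one_add_rpow_le_exp (e' δ : ℝ) (he' : 0 ≤ e') (hδ : 0 < δ) :
    ∃ K : ℝ, 0 ≤ K ∧ ∀ s : ℝ, 0 ≤ s → (1 + s) ^ e' ≤ K * Real.exp (δ * s) := by
  by_cases hle : e' ≤ δ
  · refine ⟨1, zero_le_one, fun s hs => ?_⟩
    rw [one_mul]
    have h1 : 1 + s ≤ Real.exp s := by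
      have := Real.add_one_le_exp s
      linarith
    calc (1 + s) ^ e' ≤ (Real.exp s) ^ e' := Real.rpow_le_rpow (by positivity) h1 he'
      _ = Real.exp (s * e') := (Real.exp_mul s e').symm
      _ ≤ Real.exp (δ * s) := Real.exp_le_exp.mpr (by nlinarith)
  · have hlt : δ < e' := not_le.mp hle
    have he'pos : 0 < e' := hδ.trans hlt
    refine ⟨(e' / δ) ^ e', by positivity, fun s hs => ?_⟩
    have hq : 1 ≤ e' / δ := by rw [le_div_iff₀ hδ]; linarith
    have h1 : 1 + s ≤ (e' / δ) * Real.exp (δ / e' * s) := by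
      have h2 : 1 + δ / e' * s ≤ Real.exp (δ / e' * s) := by
        have := Real.add_one_le_exp (δ / e' * s)
        linarith
      have h3 : 1 + s ≤ (e' / δ) * (1 + δ / e' * s) := by
        have : (e' / δ) * (δ / e' * s) = s := by field_simp
        rw [mul_add, this, mul_one]
        linarith
      exact h3.trans (mul_le_mul_of_nonneg_left h2 (by positivity))
    calc (1 + s) ^ e' ≤ ((e' / δ) * Real.exp (δ / e' * s)) ^ e' :=
          Real.rpow_le_rpow (by positivity) h1 he'
      _ = (e' / δ) ^ e' * (Real.exp (δ / e' * s)) ^ e' :=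
          Real.mul_rpow (by positivity) (Real.exp_pos _).le
      _ = (e' / δ) ^ e' * Real.exp (δ / e' * s * e') := by rw [← Real.exp_mul]
      _ = (e' / δ) ^ e' * Real.exp (δ * s) := by
          congr 2
          field_simp

namespace T4Data

variable (X : T4Data)

/-! ### 2. The exact `H`-Gaussian: product form, non-negativity, `U(H)(E′)`-invariance -/

open scoped Classical in
/-- `gaussDef` as a `Finset` product over the definite embeddings. -/
theorem gaussDef_eq_prod (x : Fin 3 → X.E) :
    X.gaussDef x = ∏ σ ∈ Finset.univ.filter (fun σ : X.E →+* ℂ => σ ≠ X.τ₀ ∧ σ ≠ conjEmb X.τ₀),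
      Real.exp (-(Real.pi * |(star (fun i => σ (x i)) ⬝ᵥ ((X.H.map σ) *ᵥ (fun i => σ (x i)))).re|)) := by
  unfold gaussDef
  exact finprod_cond_eq_prod_of_cond_iff _ fun {σ} _ => by simp

/-- `0 ≤ gaussDef`. -/
theorem gaussDef_nonneg (x : Fin 3 → X.E) : 0 ≤ X.gaussDef x := by
  classical
  rw [X.gaussDef_eq_prod]
  exact Finset.prod_nonneg fun σ _ => (Real.exp_pos _).le

/-- **The exact `H`-Gaussian is `U(H)(E′)`-invariant on the nose**: `gaussDef (γ x) = gaussDef x` for every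
`γ` with `γ^* H γ = H` — the value `σ ⟨x, x⟩_H` at each embedding is unchanged (`hform_unitary`). -/
theorem gaussDef_mulVec_of_unitary {γ : Matrix (Fin 3) (Fin 3) X.E} (hγ : IsUnitaryOf X.c X.H γ) (x : Fin 3 → X.E) :
    X.gaussDef (γ *ᵥ x) = X.gaussDef x := by
  classical
  rw [X.gaussDef_eq_prod, X.gaussDef_eq_prod]
  refine Finset.prod_congr rfl fun σ _ => ?_
  rw [← X.map_hform_eq_dotProduct, ← X.map_hform_eq_dotProduct, X.hform_unitary hγ]

/-! ### 3. The polynomial of the definite sizes, absorbed by the Gaussian -/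

/-- The polynomial `∏_{σ def} (1 + Σ_i ‖σ x_i‖²)^{e′}` of the sizes of `x` at the definite embeddings. -/
def defPoly (e' : ℝ) (x : Fin 3 → X.E) : ℝ :=
  ∏ᶠ (σ : X.E →+* ℂ) (_ : σ ≠ X.τ₀ ∧ σ ≠ conjEmb X.τ₀), (1 + ∑ i, ‖σ (x i)‖ ^ 2) ^ e'

open scoped Classical in
/-- `defPoly` as a `Finset` product over the definite embeddings. -/
theorem defPoly_eq_prod (e' : ℝ) (x : Fin 3 → X.E) :
    X.defPoly e' x = ∏ σ ∈ Finset.univ.filter (fun σ : X.E →+* ℂ => σ ≠ X.τ₀ ∧ σ ≠ conjEmb X.τ₀),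
      (1 + ∑ i, ‖σ (x i)‖ ^ 2) ^ e' := by
  unfold defPoly
  exact finprod_cond_eq_prod_of_cond_iff _ fun {σ} _ => by simp

/-- `0 ≤ defPoly`. -/
theorem defPoly_nonneg (e' : ℝ) (x : Fin 3 → X.E) : 0 ≤ X.defPoly e' x := by
  classical
  rw [X.defPoly_eq_prod]
  exact Finset.prod_nonneg fun σ _ => Real.rpow_nonneg (by positivity) _

/-- **Definiteness at one embedding, for the real part**: at a definite `σ` there is `lam > 0` with
`lam · Σ_i ‖σ x_i‖² ≤ |Re (σ x)^* σ(H) (σ x)|` for every `x`. -/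
theorem exists_pos_mul_sum_norm_sq_le_abs_re (σ : X.E →+* ℂ) :
    ∃ lam : ℝ, 0 < lam ∧ (σ ≠ X.τ₀ → σ ≠ conjEmb X.τ₀ → ∀ x : Fin 3 → X.E,
      lam * ∑ i, ‖σ (x i)‖ ^ 2 ≤ |(star (fun i => σ (x i)) ⬝ᵥ ((X.H.map σ) *ᵥ (fun i => σ (x i)))).re|) := by
  by_cases hdef : σ ≠ X.τ₀ ∧ σ ≠ conjEmb X.τ₀
  · obtain ⟨hσ, hσ'⟩ := hdef
    rcases X.hDef σ hσ hσ' with hpos | hneg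
    · obtain ⟨lam, hlam, h⟩ := exists_pos_mul_sum_norm_sq_le_re_dotProduct_mulVec hpos
      exact ⟨lam, hlam, fun _ _ x => (h _).trans (le_abs_self _)⟩
    · obtain ⟨lam, hlam, h⟩ := exists_pos_mul_sum_norm_sq_le_re_dotProduct_mulVec hneg
      refine ⟨lam, hlam, fun _ _ x => ?_⟩
      have h1 := h (fun i => σ (x i))
      rw [Matrix.neg_mulVec, dotProduct_neg, Complex.neg_re] at h1
      exact h1.trans (neg_le_abs _)
  · exact ⟨1, zero_lt_one, fun hσ hσ' => absurd ⟨hσ, hσ'⟩ hdef⟩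

/-- **A uniform definiteness constant**: one `lam > 0` for all definite embeddings. -/
theorem exists_uniform_pos_mul_sum_norm_sq_le_abs_re :
    ∃ lam : ℝ, 0 < lam ∧ ∀ σ : X.E →+* ℂ, σ ≠ X.τ₀ → σ ≠ conjEmb X.τ₀ → ∀ x : Fin 3 → X.E,
      lam * ∑ i, ‖σ (x i)‖ ^ 2 ≤ |(star (fun i => σ (x i)) ⬝ᵥ ((X.H.map σ) *ᵥ (fun i => σ (x i)))).re| := by
  classical
  choose lam hlam hl using X.exists_pos_mul_sum_norm_sq_le_abs_re
  have hpos : ∀ σ, 0 < min (lam σ) 1 := fun σ => lt_min (hlam σ) zero_lt_one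
  refine ⟨∏ σ : X.E →+* ℂ, min (lam σ) 1, Finset.prod_pos fun σ _ => hpos σ, fun σ hσ hσ' x => ?_⟩
  have hle : ∏ σ' : X.E →+* ℂ, min (lam σ') 1 ≤ lam σ := by
    calc ∏ σ' : X.E →+* ℂ, min (lam σ') 1
        = min (lam σ) 1 * ∏ σ' ∈ Finset.univ.erase σ, min (lam σ') 1 :=
          (Finset.mul_prod_erase _ _ (Finset.mem_univ σ)).symm
      _ ≤ min (lam σ) 1 * 1 :=
          mul_le_mul_of_nonneg_left
            (Finset.prod_le_one (fun σ' _ => (hpos σ').le) fun σ' _ => min_le_right _ _) (hpos σ).le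
      _ ≤ lam σ := by rw [mul_one]; exact min_le_left _ _
  have hs : 0 ≤ ∑ i, ‖σ (x i)‖ ^ 2 := Finset.sum_nonneg fun _ _ => by positivity
  exact (mul_le_mul_of_nonneg_right hle hs).trans (hl σ hσ hσ' x)

/-- **The polynomial of the definite sizes is absorbed by the exact Gaussian**: for every `e′ ≥ 0` there are
`c₁ > 0` and `K ≥ 0` with `defPoly e′ x · gaussDef x ≤ K · gaussDefAt c₁ x` for all `x`. -/
theorem exists_defPoly_mul_gaussDef_le_gaussDefAt (e' : ℝ) (he' : 0 ≤ e') :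
    ∃ c₁ K : ℝ, 0 < c₁ ∧ 0 ≤ K ∧ ∀ x : Fin 3 → X.E, X.defPoly e' x * X.gaussDef x ≤ K * X.gaussDefAt c₁ x := by
  classical
  obtain ⟨lam, hlam, hl⟩ := X.exists_uniform_pos_mul_sum_norm_sq_le_abs_re
  set δ : ℝ := Real.pi * lam / 2 with hδ
  have hδpos : 0 < δ := by positivity
  obtain ⟨K, hK, hKs⟩ := exists_one_add_rpow_le_exp e' δ he' hδpos
  set S := Finset.univ.filter (fun σ : X.E →+* ℂ => σ ≠ X.τ₀ ∧ σ ≠ conjEmb X.τ₀) with hS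
  refine ⟨δ, ∏ _σ ∈ S, K, hδpos, Finset.prod_nonneg fun _ _ => hK, fun x => ?_⟩
  rw [X.defPoly_eq_prod, X.gaussDef_eq_prod, X.gaussDefAt_eq_prod, ← hS, ← Finset.prod_mul_distrib,
    ← Finset.prod_mul_distrib]
  refine Finset.prod_le_prod (fun σ _ => mul_nonneg (Real.rpow_nonneg (by positivity) _) (Real.exp_pos _).le)
    fun σ hσ => ?_
  rw [hS, Finset.mem_filter] at hσ
  set s : ℝ := ∑ i, ‖σ (x i)‖ ^ 2 with hs
  have hs0 : 0 ≤ s := Finset.sum_nonneg fun _ _ => by positivity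
  have hre : lam * s ≤ |(star (fun i => σ (x i)) ⬝ᵥ ((X.H.map σ) *ᵥ (fun i => σ (x i)))).re| :=
    hl σ hσ.2.1 hσ.2.2 x
  have hg : Real.exp (-(Real.pi * |(star (fun i => σ (x i)) ⬝ᵥ ((X.H.map σ) *ᵥ (fun i => σ (x i)))).re|)) ≤
      Real.exp (-(δ * s)) * Real.exp (-(δ * s)) := by
    rw [← Real.exp_add]
    apply Real.exp_le_exp.mpr
    have := mul_le_mul_of_nonneg_left hre Real.pi_pos.le
    rw [hδ]
    linarith
  calc (1 + s) ^ e' * Real.exp (-(Real.pi * |(star (fun i => σ (x i)) ⬝ᵥ ((X.H.map σ) *ᵥ (fun i => σ (x i)))).re|))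
      ≤ (K * Real.exp (δ * s)) * (Real.exp (-(δ * s)) * Real.exp (-(δ * s))) :=
        mul_le_mul (hKs s hs0) hg (Real.exp_pos _).le (by positivity)
    _ = K * Real.exp (-(δ * s)) := by
        rw [mul_assoc, ← mul_assoc (Real.exp (δ * s)), ← Real.exp_add, add_neg_cancel, Real.exp_zero, one_mul]

/-! ### 4. The witness theorem -/

/-- **THE HONEST WITNESS OF `HasCoefMajorant`: a content-like factor times the EXACT `H`-Gaussian.** If `κ ≥ 0` bounds
the theta coefficients as `‖cf j x‖ ≤ C κ(x) gaussDef(x)`, is `Γ`-invariant, is moved by at most `q₃^N` under the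
representatives of the depth-`N` localiser, and is of polynomial size `κ x ≤ A (1 + ‖y(x)‖)^e · defPoly e′ x`, then
`HasCoefMajorant D ℓ` holds with `m = κ · gaussDef / max (A K) 1` — the Euclidean Gaussian never enters `m`. -/
theorem hasCoefMajorant_of_content (D : X.ThetaData)
    {p : IsDedekindDomain.HeightOneSpectrum (RingOfIntegers X.E)}
    {L₀ : Submodule (RingOfIntegers X.E) (Fin 3 → X.E)} {xm : X.Tuple} (ℓ : X.LocS D p L₀ xm)
    (κ : (Fin 3 → X.E) → ℝ) {C q₃ A e e' : ℝ} (hC : 0 ≤ C) (hq₃ : 0 ≤ q₃) (hA : 0 ≤ A) (he' : 0 ≤ e')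
    (hκ0 : ∀ x, 0 ≤ κ x)
    (hcf : ∀ j x, ‖D.cf j x‖ ≤ C * κ x * X.gaussDef x)
    (hκΓ : ∀ γ ∈ X.Γ, ∀ x, κ (γ *ᵥ x) = κ x)
    (hκrep : ∀ N r, X.IsRepOf (ℓ.loc N) r → ∀ x, κ (r *ᵥ x) ≤ q₃ ^ N * κ x)
    (hκpoly : ∀ x, κ x ≤ A * (1 + ‖X.ballCoord x‖) ^ e * X.defPoly e' x) :
    X.HasCoefMajorant D ℓ := by
  obtain ⟨c₁, K, hc₁, hK, hKx⟩ := X.exists_defPoly_mul_gaussDef_le_gaussDefAt e' he'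
  set M₀ : ℝ := max (A * K) 1 with hM₀
  have hM₀pos : 0 < M₀ := lt_of_lt_of_le zero_lt_one (le_max_right _ _)
  have hAK : A * K ≤ M₀ := le_max_left _ _
  refine ⟨fun x => κ x * X.gaussDef x / M₀, C * M₀, q₃, e, c₁, by positivity, hq₃, hc₁,
    fun x => div_nonneg (mul_nonneg (hκ0 x) (X.gaussDef_nonneg x)) hM₀pos.le, fun j x => ?_,
    fun γ hγ x => ?_, fun N r hr x => ?_, fun x => ?_⟩
  · -- the bound on the coefficients
    calc ‖D.cf j x‖ ≤ C * κ x * X.gaussDef x := hcf j x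
      _ = C * M₀ * (κ x * X.gaussDef x / M₀) := by field_simp
  · -- `Γ`-invariance
    simp only [hκΓ γ hγ x, X.gaussDef_mulVec_of_unitary (X.isUnitaryOf_of_mem_Γ hγ) x]
  · -- the representatives: `r ∈ U(H)(E′)` (coset representative of a Hecke element of the level), so the exact
    -- Gaussian is unchanged and only `κ` moves
    obtain ⟨h, _, k, t, ht, hrt⟩ := hr
    have hru : IsUnitaryOf X.c X.H r :=
      HeckeEquivariance.isUnitaryOf_of_isFor X (ℓ.level N) (h.2 (X.slot k)) ht hrt
    dsimp only
    rw [X.gaussDef_mulVec_of_unitary hru x]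
    have h1 := mul_le_mul_of_nonneg_right (hκrep N r ⟨h, ‹_›, k, t, ht, hrt⟩ x) (X.gaussDef_nonneg x)
    calc κ (r *ᵥ x) * X.gaussDef x / M₀ ≤ q₃ ^ N * κ x * X.gaussDef x / M₀ :=
          div_le_div_of_nonneg_right h1 hM₀pos.le
      _ = q₃ ^ N * (κ x * X.gaussDef x / M₀) := by ring
  · -- the archimedean clause: polynomial × exact Gaussian ≤ the Euclidean Gaussian, the constant absorbed by `M₀`
    have hpoly : 0 ≤ (1 + ‖X.ballCoord x‖) ^ e := Real.rpow_nonneg (by positivity) _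
    have hg0 : 0 ≤ X.gaussDef x := X.gaussDef_nonneg x
    have h1 : κ x * X.gaussDef x ≤ A * (1 + ‖X.ballCoord x‖) ^ e * (X.defPoly e' x * X.gaussDef x) := by
      calc κ x * X.gaussDef x ≤ A * (1 + ‖X.ballCoord x‖) ^ e * X.defPoly e' x * X.gaussDef x :=
            mul_le_mul_of_nonneg_right (hκpoly x) hg0
        _ = A * (1 + ‖X.ballCoord x‖) ^ e * (X.defPoly e' x * X.gaussDef x) := by ring
    have h2 : A * (1 + ‖X.ballCoord x‖) ^ e * (X.defPoly e' x * X.gaussDef x) ≤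
        A * (1 + ‖X.ballCoord x‖) ^ e * (K * X.gaussDefAt c₁ x) :=
      mul_le_mul_of_nonneg_left (hKx x) (mul_nonneg hA hpoly)
    have hG : 0 ≤ X.gaussDefAt c₁ x := X.gaussDefAt_nonneg _ _
    calc κ x * X.gaussDef x / M₀ ≤ A * (1 + ‖X.ballCoord x‖) ^ e * (K * X.gaussDefAt c₁ x) / M₀ :=
          div_le_div_of_nonneg_right (h1.trans h2) hM₀pos.le
      _ = (A * K / M₀) * ((1 + ‖X.ballCoord x‖) ^ e * X.gaussDefAt c₁ x) := by ring
      _ ≤ 1 * ((1 + ‖X.ballCoord x‖) ^ e * X.gaussDefAt c₁ x) :=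
          mul_le_mul_of_nonneg_right ((div_le_one hM₀pos).mpr hAK) (mul_nonneg hpoly hG)
      _ = (1 + ‖X.ballCoord x‖) ^ e * X.gaussDefAt c₁ x := one_mul _

/-- **L3.5 FROM THE CONTENT WITNESS**: the summable majorant of the off-main orbital terms from the size clause of the
localiser, a content-like factor `κ` with the exact `H`-Gaussian, and `hlit`. -/
theorem term_dominated_of_content_lit (D : X.ThetaData)
    (p : IsDedekindDomain.HeightOneSpectrum (RingOfIntegers X.E))
    (L₀ : Submodule (RingOfIntegers X.E) (Fin 3 → X.E)) (xm : X.Tuple)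
    (h02 : xm 2 = xm 0) (h13 : xm 3 = xm 1) (hab : LinearIndependent X.E ![xm 0, xm 1]) (ℓ : X.LocS D p L₀ xm)
    (hsize : X.LocSize D ℓ)
    (κ : (Fin 3 → X.E) → ℝ) {C q₃ A e e' : ℝ} (hC : 0 ≤ C) (hq₃ : 0 ≤ q₃) (hA : 0 ≤ A) (he' : 0 ≤ e')
    (hκ0 : ∀ x, 0 ≤ κ x)
    (hcf : ∀ j x, ‖D.cf j x‖ ≤ C * κ x * X.gaussDef x)
    (hκΓ : ∀ γ ∈ X.Γ, ∀ x, κ (γ *ᵥ x) = κ x)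
    (hκrep : ∀ N r, X.IsRepOf (ℓ.loc N) r → ∀ x, κ (r *ᵥ x) ≤ q₃ ^ N * κ x)
    (hκpoly : ∀ x, κ x ≤ A * (1 + ‖X.ballCoord x‖) ^ e * X.defPoly e' x)
    (hlit : Lit.BorelHarishChandra1962_Thm11_8_fundamentalDomain_hdef X.E X.H X.τ₀ X.C) :
    ∃ bound : X.Orbit → ℝ, (∀ o, 0 ≤ bound o) ∧ Summable bound ∧
      ∀ N (o : X.Orbit), o ≠ X.orbitOf (X.lines xm) →
        ‖X.term D.Φ D.cf (ℓ.level N) (ℓ.loc N) o‖ ≤ bound o :=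
  X.term_dominated_of_coefMajorant_lit D p L₀ xm h02 h13 hab ℓ hsize
    (X.hasCoefMajorant_of_content D ℓ κ hC hq₃ hA he' hκ0 hcf hκΓ hκrep hκpoly) hlit

end T4Data

end Summit.Ventures.HodgeRepro.Tier4.Line3

end
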